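import Summits.BirchSwinnertonDyer.Rank1Residual.X1.TamagawaSqueeze
import HarnessLib

/-!
# Route G — the GREENBERG–VATSAL CONGRUENCE TRANSFER of `λ` on the leaf X1 ∩ {r = 0}:
# `E₀[p] ≅ E₀'[p]`, both `μ = 0`, Mazur's main conjecture at `E₀'` ⇒ `λ_alg(E₀)` is determined ⇒
# (squeeze of route T) Mazur's main conjecture and `BSD(E,p)` at `E₀`

HONEST FRAMING (cell `b2b-bsdres`, run/shared/lean/b2b/bsd-rank1-residual/, verbatim in every
file): the goal of the cell is to DELETE the COMBINATION-SHAPED residual classes of the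
Birch–Swinnerton-Dyer formula for ALL analytic-rank `≤ 1` elliptic curves over `ℚ` — "full BSD
formula for every rank `≤ 1` curve in class `C`" assembled STRICTLY from published theorems — so
that the rank-`≤ 1` remainder becomes exactly the CONSTRUCTION-SHAPED classes, which are TYPED
(missing-input `Prop`s), NOT attempted. This is not "finishing BSD". Sub-cell
`b2b-bsdres-eisenstein-p1` (CLASS-OWNERS row "X1 (r=0)"), gen 7: research route; NO CLAIM BEYOND
STATED CLASSES; nothing here changes a label. TWO defs, both vocabulary/typed input (`TorsionIso`,
the printed hypothesis "`E₁[p] ≅ E₂[p]` as Galois modules" of Greenberg–Vatsal's Thm. (1.4), spelled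
exactly as in `Literature/…/GreenbergVatsal2000/CongruentCurves.lean`; `CongruentLambdaShift`, the
per-pair transfer statement, nothing asserted); everything else is a theorem over PUBLISHED named
facts and the cell's typed per-pair inputs (`AnalyticLambdaEq`, `AnalyticMuLE`, `MazurMainConjecture`
at the PARTNER).

WHY THIS FILE. Routes P/T/C (gens 5–6) bound `λ_alg(E,p) = λ(X(E/ℚ_∞))` from below by invariants of
`E` itself (parity, Tamagawa kernels over the tower, points over `ℚ_1`). Greenberg–Vatsal, Invent.
Math. 142 (2000), §2, show that `λ` is — up to EXPLICIT local terms — an invariant of the residual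
representation: (p. 26, last paragraph – p. 27) "by proposition (2.8), we have
`Sel^{Σ₀}_{E_i}(ℚ_∞)[p] = S^{Σ₀}_{A_i}(ℚ_∞)[p] ≅ S^{Σ₀}_{A_i[p]}(ℚ_∞)`. Furthermore, the order of
this group is independent of `i` since `A₁[p] ≅ A₂[p]` as `G_ℚ`-modules. As a consequence, we see
that if `μ_{E₁} = 0`, then `μ_{E₂} = 0` and `λ^{Σ₀}_{E₂} = λ^{Σ₀}_{E₁}`. … The above discussion shows
that if `p` is an odd prime, `E₁[p] ≅ E₂[p]` as `G_ℚ`-modules, and `μ^{alg}_{E₁} = 0`, then one can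
compute `λ^{alg}_{E₂}` if one knows `λ^{alg}_{E₁}`", with `λ^{Σ₀}_E = λ_E + Σ_{ℓ ∈ Σ₀} δ_E(ℓ)`
((6)–(9): Cor. 2.3, Prop. 2.4), `δ_E(ℓ) = s_ℓ · d_ℓ`, `s_ℓ = p^{ord_p(ℓ^{p−1}−1)−1}` the number of
primes of `ℚ_∞` above `ℓ` and `d_ℓ` the multiplicity of `ℓ^{-1}` as a root of the Euler factor
`P_ℓ(X) mod p` (p. 27, the example `52a/364a @ 5`: "`1 + 2X + 7X² ≡ (1 − X)(1 − 2X) (mod 5)` and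
`X = 7̃^{-1}` has multiplicity 1 as a root. Also `5² ∥ 7⁴ − 1` and so `s₇ = 5` … `δ^{(7)}_{E₁} = 5`").
The hypothesis printed in Prop. (2.8) is `H⁰(ℚ, E[p]) = 0`, NOT irreducibility (Thm. (1.4) assumes
irreducible `E[p]` for its ANALYTIC half, §3); when `E(ℚ)[p] ≠ 0` one adds the remark
`dim_{𝔽_p} S^{Σ₀}_{A[p]}(ℚ_∞) = λ^{Σ₀} + dim_{𝔽_p} E(ℚ_∞)[p]` (HOME/b2b-bsdres-eisenstein-p1/
X1R0-GAPMAP.md §16.0; the correction depends on `A[p]` only, so `λ^{Σ₀}` is an invariant of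
(`E[p]`, `μ = 0`) for every `E/ℚ` good ordinary at odd `p`). So for two leaf classes whose `μ = 0`
members have ISOMORPHIC `E₀[p]`, **`λ_alg(E₀) = λ_alg(E₀') + e`** with the integer
`e = Σ_{ℓ ∣ NN', ℓ ≠ p} s_ℓ (d_ℓ(E₀') − d_ℓ(E₀))` read off the reduction types — and if Mazur's main
conjecture is known at `E₀'` (routes S/P/T/C at `r = 0`, x1b's P1/P3 at `r = 1`) then
`λ_alg(E₀) = λ_an(E₀') + e` is KNOWN, and route T's squeeze closes `E₀` as soon as this integer is
`≥ λ_an(E₀) − 1`. That composition lives OUTSIDE the kernel (the tree has no non-primitive Selmer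
groups of `E[p]` over `ℚ_∞`); it is a per-pair CERTIFICATE whose finite data are: the isomorphism
class of `E₀[3]` — at `p = 3`, EXACTLY, as (the even character `φ = χ_d`, the Kummer line in
`ℚ^×/ℚ^{×3}` of the extension class, read off the `3`-division polynomial), two certified `λ_an`, two
certified `μ_an = 0`, reduction types and `s_ℓ` (`HOME/b2b-bsdres-eisenstein-p1/routeG/`: on the 1 389
X1 classes at `p = 3`, `N < 2·10⁴`, EVERY one of the 794 closed–closed predictions is exact, 14 open
`r = 0` classes close (census reach 643/770), 69 `r = 1` classes get the λ-part).

* `TorsionIso`, `CongruentLambdaShift` (TYPED) — §1; `isTorsion_and_lambdaInvariant_eq_of_mazurMainConjecture`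
  (at the partner `λ(X') = n'`) — §2; `lambdaInvariant_eq_of_congruentLambdaShift` (`λ(X) = n' + e`),
  `lambdaPartAt_of_congruentLambdaShift(_of_even)`, `mazurMainConjecture_of_congruentLambdaShift_of_even`
  — §3; `Leaf.mazurMainConjecture_of_congruent`, **`Leaf.bsdp_of_muZero_of_congruent(_leaf)`**,
  `Leaf.le_of_congruentLambdaShift` (consistency, Kato's direction) — §4.

References: [GreenbergVatsal2000] §2: Props. (2.1), (2.4), (2.5), (2.8), Cor. (2.3), pp. 24–27 of
arXiv:math/9906215; [GreenbergLNM1716] Prop. 3.10, p. 161; [Wuthrich2014] Thm. 16;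
HOME/b2b-bsdres-eisenstein-p1/X1R0-GAPMAP.md §16.
-/

noncomputable section

open scoped Classical MatrixGroups ModularForm

open PowerSeries CongruenceSubgroup WeierstrassCurve Literature.NumberTheory.EllipticCurves
  Literature.NumberTheory.EllipticCurves.ModularForms
  Literature.NumberTheory.EllipticCurves.Rank1Residual
  Literature.NumberTheory.EllipticCurves.Greenberg1999
  Summit.BirchSwinnertonDyer.BirchSwinnertonDyer.Theorems.Rank1ResidualX1Defs
  Summit.BirchSwinnertonDyer.Rank1Residual.X1.MuLambda
  Summit.BirchSwinnertonDyer.Rank1Residual.X1.MuPart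
  Summit.BirchSwinnertonDyer.Rank1Residual.X1.ParitySqueeze
  Summit.BirchSwinnertonDyer.Rank1Residual.X1.TamagawaSqueeze

set_option autoImplicit false

namespace Summit.BirchSwinnertonDyer.Rank1Residual.X1.CongruenceTransfer

/-! ## §1. "`E[p] ≅ E'[p]`" and the transfer statement, TYPED -/

/-- **"`E[p] ≅ E'[p]` as Galois modules"**: a `Γ_ℚ`-equivariant additive isomorphism between the
geometric `p`-torsion subgroups — the hypothesis of Greenberg–Vatsal's Thm. (1.4), spelled as in
`GreenbergVatsal2000.thm14_mainConjecture_transfer_of_torsionIso`. At `p = 3` on the leaf it is decided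
per pair by the key `(d, Kummer line)` of HOME/b2b-bsdres-eisenstein-p1/X1R0-GAPMAP.md §16.1.
[cite: GreenbergVatsal2000, Thm. (1.4) (hypothesis "E₁[p] ≅ E₂[p] as Galois modules", arXiv p. 5)] -/
def TorsionIso (W W' : WeierstrassCurve ℚ) (p : ℕ) : Prop :=
  ∃ e : geomTorsion W (p : ℤ) ≃+ geomTorsion W' (p : ℤ),
    ∀ (σ : Field.absoluteGaloisGroup ℚ) (P : geomTorsion W (p : ℤ)), e (σ • P) = σ • e P

/-- `TorsionIso` is symmetric. [folklore] -/
theorem TorsionIso.symm {W W' : WeierstrassCurve ℚ} {p : ℕ} (h : TorsionIso W W' p) :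
    TorsionIso W' W p := by
  obtain ⟨e, he⟩ := h
  refine ⟨e.symm, fun σ Q ↦ ?_⟩
  apply e.injective
  rw [e.apply_symm_apply, he, e.apply_symm_apply]

/-- **"`λ(E) = λ(E') + e` for congruent curves with `μ = 0`" (TYPED; nothing asserted).** IF
`E[p] ≅ E'[p]` as Galois modules THEN, for the cyclotomic `ℤ_p`-extension `κ`, a topological
generator `γ` matching the cyclotomic variable, and ALL Pontryagin-dual data `D` of `E` and `D'` of `E'`
(finitely generated, `Λ`-torsion) with `μ(D.X) = μ(D'.X) = 0`: `λ(D.X) = λ(D'.X) + e`. An INPUT of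
route G, supplied per pair OUTSIDE the kernel by Greenberg–Vatsal 2000 §2 (Props. 2.4, 2.8, Cor. 2.3:
`λ^{Σ₀}` is an invariant of `E[p]` when `μ = 0`; plus the remark of X1R0-GAPMAP §16.0 when
`E(ℚ)[p] ≠ 0`) with `e = Σ_{ℓ ∣ NN', ℓ ≠ p} s_ℓ·(d_ℓ(E') − d_ℓ(E))`, `s_ℓ = p^{ord_p(ℓ^{p−1}−1)−1}`,
`d_ℓ` = multiplicity of `ℓ^{-1}` as a root of the Euler factor `P_ℓ mod p`.
[cite: GreenbergVatsal2000, §2 Prop. (2.8), Cor. (2.3), Prop. (2.4) and p. 27 (shape only; nothing asserted)] -/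
def CongruentLambdaShift (W W' : WeierstrassCurve ℚ) [W.IsElliptic] [W.IsGloballyMinimal]
    [W'.IsElliptic] [W'.IsGloballyMinimal] (p : ℕ) [Fact p.Prime] (e : ℤ) : Prop :=
  TorsionIso W W' p →
  ∀ (κ : ZpExtension ℚ p) (γ : Field.absoluteGaloisGroup ℚ),
      κ.IsCyclotomic → κ.IsTopGenerator γ → IsCyclotomicVariable p γ →
    ∀ (D : W.SelmerDualData κ γ) (D' : W'.SelmerDualData κ γ)
      [Module.Finite (IwasawaAlgebra p) D.X] [Module.Finite (IwasawaAlgebra p) D'.X],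
      D.IsTorsion → D'.IsTorsion → D.mu = 0 → D'.mu = 0 →
      (lambdaInvariant p D.X : ℤ) = (lambdaInvariant p D'.X : ℤ) + e

/-! ## §2. At the partner: Mazur's main conjecture and `λ_an = n'` give `λ(X') = n'` -/

section Partner

variable {W' : WeierstrassCurve ℚ} [W'.IsElliptic] [W'.IsGloballyMinimal] {p : ℕ} [Fact p.Prime]

/-- **`λ(X(E'/ℚ_∞)) = n'` at a CLOSED partner.** `W'/ℚ` globally minimal elliptic, `p` good ordinary,
Mazur's main conjecture at `(E', p)` (per pair: routes S/P/T/C/P1/P3) and `λ_an(E',p) = n'`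
(`AnalyticLambdaEq W' p n'`); modularity (`hmod`, BCDT + Edixhoven: the newform and `ϖ'`) to
instantiate. Then for the cyclotomic data and EVERY dual datum `D'`: `X'` is torsion and `λ(X') = n'`
(`char X' = (g')`, `ι g' = ϖ'·L_p`, `λ(X') = λ(g')` by the structure theorem,
`ParitySqueeze.lam_generator_eq_lambdaInvariant`). [cite: BCDTJAMS2001, Theorem A]
[cite: Washington1997, §13.2] -/
theorem isTorsion_and_lambdaInvariant_eq_of_mazurMainConjecture
    (hmod : nonempty_modularParametrizationData)
    (hgood : W'.HasGoodReductionAtPrime p) (hord : ¬ (p : ℤ) ∣ W'.frobeniusTrace p)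
    (hMC : MazurMainConjecture W' p) {n' : ℕ} (hlam : AnalyticLambdaEq W' p n')
    {κ : ZpExtension ℚ p} {γ : Field.absoluteGaloisGroup ℚ}
    (hκ : κ.IsCyclotomic) (hγ : κ.IsTopGenerator γ) (hγ' : IsCyclotomicVariable p γ)
    (D' : W'.SelmerDualData κ γ) :
    D'.IsTorsion ∧ lambdaInvariant p D'.X = n' := by
  haveI : NeZero (W'.conductorNorm ℤ) := ⟨(W'.conductorNorm_pos_holds).ne'⟩
  haveI : Module.Finite (IwasawaAlgebra p) D'.X := D'.module_finite_holds hγ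
  obtain ⟨Dm⟩ := hmod W'
  have hf : IsNewformOf W' Dm.f := Dm.isNewformOf
  obtain ⟨ϖ, -, hϖ, -⟩ := Dm.exists_rat_mul_realPeriodRat_eq_plusPeriod
  obtain ⟨hX, g, hchar, hι⟩ := hMC κ γ hκ hγ hγ' Dm.f hf ϖ hϖ D'
  have hι1 : iwasawaToPowerSeries p (g * 1) =
      C (ϖ : ℚ_[p]) * padicLFunction Dm.f (unitRoot W' p : ℚ_[p]) := by rw [mul_one, hι]
  have hg1 : g * 1 ≠ 0 := mul_ne_zero_of_iota_eq hgood hord hf hϖ D' hι1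
  have hg : g ≠ 0 := by rwa [mul_one] at hg1
  have h1 : lam g = n' := by
    have := hlam Dm.f hf ϖ hϖ (g * 1) hι1
    rwa [mul_one] at this
  exact ⟨hX, (lam_generator_eq_lambdaInvariant D'.X hX hg hchar).symm.trans h1⟩

end Partner

/-! ## §3. Route G: the transferred lower bound and the squeeze -/

section Transfer

variable {W W' : WeierstrassCurve ℚ} [W.IsElliptic] [W.IsGloballyMinimal]
  [W'.IsElliptic] [W'.IsGloballyMinimal] {p : ℕ} [Fact p.Prime]

/-- **The transferred value of `λ_alg(E₀)`.** Good ordinary Eisenstein pairs `(E₀, p)`, `(E₀', p)`,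
`p ≠ 2`; granted Wuthrich 2014 Thm. 16 (`hW16`) and modularity (`hmod`), both PUBLISHED: if
`μ_an(E₀) = 0` and `μ_an(E₀') = 0` (`AnalyticMuLE _ p 0`; then `μ(X) = μ(X') = 0` by Kato's
divisibility, `MuPart.mu_eq_zero_of_analyticMuLE_zero`), Mazur's main conjecture holds at `E₀'` with
`λ_an(E₀') = n'`, `E₀[p] ≅ E₀'[p]` and `CongruentLambdaShift W W' p e`, then for the cyclotomic data and
every dual datum `D` of `E₀`: `X` is torsion and **`λ(X) = n' + e`** (in `ℤ`).
[cite: GreenbergVatsal2000, §2 Prop. (2.8), Cor. (2.3), Prop. (2.4), p. 27]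
[cite: Wuthrich2014, Thm. 16 (p. 397)] -/
theorem lambdaInvariant_eq_of_congruentLambdaShift
    (hW16 : Wuthrich2014.charIdeal_dvd_padicLFunction) (hmod : nonempty_modularParametrizationData)
    (hp : p ≠ 2) (hgood : W.HasGoodReductionAtPrime p) (hord : ¬ (p : ℤ) ∣ W.frobeniusTrace p)
    (hred : ¬ W.HasIrreducibleModPGaloisRep p)
    (hgood' : W'.HasGoodReductionAtPrime p) (hord' : ¬ (p : ℤ) ∣ W'.frobeniusTrace p)
    (hred' : ¬ W'.HasIrreducibleModPGaloisRep p)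
    (hμ : AnalyticMuLE W p 0) (hμ' : AnalyticMuLE W' p 0)
    (hMC' : MazurMainConjecture W' p) {n' : ℕ} (hlam' : AnalyticLambdaEq W' p n')
    (hiso : TorsionIso W W' p) {e : ℤ} (hG : CongruentLambdaShift W W' p e)
    {κ : ZpExtension ℚ p} {γ : Field.absoluteGaloisGroup ℚ}
    (hκ : κ.IsCyclotomic) (hγ : κ.IsTopGenerator γ) (hγ' : IsCyclotomicVariable p γ)
    (D : W.SelmerDualData κ γ) :
    D.IsTorsion ∧ (lambdaInvariant p D.X : ℤ) = n' + e := by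
  haveI : NeZero (W.conductorNorm ℤ) := ⟨(W.conductorNorm_pos_holds).ne'⟩
  haveI : Module.Finite (IwasawaAlgebra p) D.X := D.module_finite_holds hγ
  obtain ⟨D'⟩ := W'.nonempty_selmerDualData_holds κ γ hγ
  haveI : Module.Finite (IwasawaAlgebra p) D'.X := D'.module_finite_holds hγ
  obtain ⟨hX, -⟩ := isTorsion_and_exists_factorisation hW16 hmod hp hgood hord hred hκ hγ hγ' D
  obtain ⟨hX', hlamX'⟩ :=
    isTorsion_and_lambdaInvariant_eq_of_mazurMainConjecture hmod hgood' hord' hMC' hlam' hκ hγ hγ' D'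
  have hmu : D.mu = 0 := mu_eq_zero_of_analyticMuLE_zero hW16 hmod hp hgood hord hred hμ hκ hγ hγ' D
  have hmu' : D'.mu = 0 :=
    mu_eq_zero_of_analyticMuLE_zero hW16 hmod hp hgood' hord' hred' hμ' hκ hγ hγ' D'
  have key := hG hiso κ γ hκ hγ hγ' D D' hX hX' hmu hmu'
  rw [hlamX'] at key
  exact ⟨hX, key⟩

/-- **Route G, λ-part (no parity).** If moreover `λ_an(E₀) = n` with `n ≤ n' + e`, the λ-part
`LambdaPartAt W p` holds at `E₀` (`λ(f_E·h) = n ≤ n' + e = λ(X) = λ(f_E)`).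
[cite: GreenbergVatsal2000, §2 p. 27] [cite: Wuthrich2014, Thm. 16 (p. 397)] -/
theorem lambdaPartAt_of_congruentLambdaShift
    (hW16 : Wuthrich2014.charIdeal_dvd_padicLFunction) (hmod : nonempty_modularParametrizationData)
    (hp : p ≠ 2) (hgood : W.HasGoodReductionAtPrime p) (hord : ¬ (p : ℤ) ∣ W.frobeniusTrace p)
    (hred : ¬ W.HasIrreducibleModPGaloisRep p)
    (hgood' : W'.HasGoodReductionAtPrime p) (hord' : ¬ (p : ℤ) ∣ W'.frobeniusTrace p)
    (hred' : ¬ W'.HasIrreducibleModPGaloisRep p)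
    (hμ : AnalyticMuLE W p 0) (hμ' : AnalyticMuLE W' p 0)
    (hMC' : MazurMainConjecture W' p) {n' : ℕ} (hlam' : AnalyticLambdaEq W' p n')
    (hiso : TorsionIso W W' p) {e : ℤ} (hG : CongruentLambdaShift W W' p e)
    {n : ℕ} (hlam : AnalyticLambdaEq W p n) (hn : (n : ℤ) ≤ n' + e) : LambdaPartAt W p := by
  intro κ γ hκ hγ hγ' _ f hf ϖ hϖ D g h hchar hι
  haveI : Module.Finite (IwasawaAlgebra p) D.X := D.module_finite_holds hγ
  obtain ⟨hX, -⟩ := hW16 W p hp ⟨hgood, hord⟩ hred hκ hγ hγ' hf D ϖ hϖ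
  have hgh : g * h ≠ 0 := mul_ne_zero_of_iota_eq hgood hord hf hϖ D hι
  have hg : g ≠ 0 := fun h0 ↦ hgh (by rw [h0, zero_mul])
  have h1 : lam (g * h) = n := hlam f hf ϖ hϖ (g * h) hι
  have h2 : lam g = lambdaInvariant p D.X := lam_generator_eq_lambdaInvariant D.X hX hg hchar
  obtain ⟨-, h3⟩ := lambdaInvariant_eq_of_congruentLambdaShift hW16 hmod hp hgood hord hred hgood'
    hord' hred' hμ hμ' hMC' hlam' hiso hG hκ hγ hγ' D
  omega

/-- **Route G, λ-part with parity.** As `lambdaPartAt_of_congruentLambdaShift`, but with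
`n ≤ n' + e + 1`, for `n` EVEN and `Sel_{p^∞}(E/ℚ)` finite (`λ(f_E)` even by Greenberg's Prop. 3.10,
`h310`, PUBLISHED): `λ(h) = n − λ(f_E)` is even and `≤ 1`, hence `0`.
[cite: GreenbergLNM1716, Prop. 3.10] [cite: GreenbergVatsal2000, §2 p. 27]
[cite: Wuthrich2014, Thm. 16 (p. 397)] -/
theorem lambdaPartAt_of_congruentLambdaShift_of_even
    (hW16 : Wuthrich2014.charIdeal_dvd_padicLFunction)
    (h310 : prop310_selmerCorank_mod_two_eq_lambdaInvariant)
    (hmod : nonempty_modularParametrizationData)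
    (hp : p ≠ 2) (hgood : W.HasGoodReductionAtPrime p) (hord : ¬ (p : ℤ) ∣ W.frobeniusTrace p)
    (hred : ¬ W.HasIrreducibleModPGaloisRep p) (hSel : Finite (W.selmerGroupPInfty p))
    (hgood' : W'.HasGoodReductionAtPrime p) (hord' : ¬ (p : ℤ) ∣ W'.frobeniusTrace p)
    (hred' : ¬ W'.HasIrreducibleModPGaloisRep p)
    (hμ : AnalyticMuLE W p 0) (hμ' : AnalyticMuLE W' p 0)
    (hMC' : MazurMainConjecture W' p) {n' : ℕ} (hlam' : AnalyticLambdaEq W' p n')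
    (hiso : TorsionIso W W' p) {e : ℤ} (hG : CongruentLambdaShift W W' p e)
    {n : ℕ} (hn : Even n) (hlam : AnalyticLambdaEq W p n) (hne : (n : ℤ) ≤ n' + e + 1) :
    LambdaPartAt W p := by
  intro κ γ hκ hγ hγ' _ f hf ϖ hϖ D g h hchar hι
  haveI : Module.Finite (IwasawaAlgebra p) D.X := D.module_finite_holds hγ
  obtain ⟨hX, -⟩ := hW16 W p hp ⟨hgood, hord⟩ hred hκ hγ hγ' hf D ϖ hϖ
  have hgh : g * h ≠ 0 := mul_ne_zero_of_iota_eq hgood hord hf hϖ D hι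
  have hg : g ≠ 0 := fun h0 ↦ hgh (by rw [h0, zero_mul])
  have hh : h ≠ 0 := fun h0 ↦ hgh (by rw [h0, mul_zero])
  have h1 : lam (g * h) = n := hlam f hf ϖ hϖ (g * h) hι
  have h2 : lam g = lambdaInvariant p D.X := lam_generator_eq_lambdaInvariant D.X hX hg hchar
  obtain ⟨-, h3⟩ := lambdaInvariant_eq_of_congruentLambdaShift hW16 hmod hp hgood hord hred hgood'
    hord' hred' hμ hμ' hMC' hlam' hiso hG hκ hγ hγ' D
  have hcork : W.selmerCorank p = 0 := by
    haveI := hSel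
    exact zpCorank_eq_zero_of_finite (W.selmerGroupPInfty p) p
  have heven : Even (lam g) := by
    rw [h2]
    exact prop310_selmerCorank_mod_two_eq_lambdaInvariant.even_lambdaInvariant_of_selmerCorank_eq_zero
      h310 W p hp hκ hγ D hX hcork
  have hgh2 : Even (lam (g * h)) := by rw [h1]; exact hn
  rw [lam_mul hg hh] at h1 hgh2 ⊢
  obtain ⟨a, ha⟩ := heven
  obtain ⟨b, hb⟩ := hgh2
  omega

/-- **Route G with parity: Mazur's main conjecture** from `λ_an(E₀) = n` even, `Sel_{p^∞}(E₀/ℚ)`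
finite, Greenberg's Prop. 3.10, the closed congruent partner and `n ≤ n' + e + 1`.
[cite: GreenbergLNM1716, Prop. 3.10] [cite: GreenbergVatsal2000, §2 p. 27]
[cite: Wuthrich2014, Thm. 16 (p. 397)] -/
theorem mazurMainConjecture_of_congruentLambdaShift_of_even
    (hW16 : Wuthrich2014.charIdeal_dvd_padicLFunction)
    (h310 : prop310_selmerCorank_mod_two_eq_lambdaInvariant)
    (hmod : nonempty_modularParametrizationData)
    (hp : p ≠ 2) (hgood : W.HasGoodReductionAtPrime p) (hord : ¬ (p : ℤ) ∣ W.frobeniusTrace p)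
    (hred : ¬ W.HasIrreducibleModPGaloisRep p) (hSel : Finite (W.selmerGroupPInfty p))
    (hgood' : W'.HasGoodReductionAtPrime p) (hord' : ¬ (p : ℤ) ∣ W'.frobeniusTrace p)
    (hred' : ¬ W'.HasIrreducibleModPGaloisRep p)
    (hμ : AnalyticMuLE W p 0) (hμ' : AnalyticMuLE W' p 0)
    (hMC' : MazurMainConjecture W' p) {n' : ℕ} (hlam' : AnalyticLambdaEq W' p n')
    (hiso : TorsionIso W W' p) {e : ℤ} (hG : CongruentLambdaShift W W' p e)
    {n : ℕ} (hn : Even n) (hlam : AnalyticLambdaEq W p n) (hne : (n : ℤ) ≤ n' + e + 1) :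
    MazurMainConjecture W p :=
  (mazurMainConjecture_iff_muPart_and_lambdaPart hW16 hp hgood hord hred).mpr
    ⟨muPartAt_of_analyticMuLE_zero hW16 hp hgood hord hred hμ,
      lambdaPartAt_of_congruentLambdaShift_of_even hW16 h310 hmod hp hgood hord hred hSel hgood' hord'
        hred' hμ hμ' hMC' hlam' hiso hG hn hlam hne⟩

end Transfer

/-! ## §4. On the leaf X1 ∩ {r = 0}: route G closes `BSD(E,p)` -/

section Leaf

variable {W W' : WeierstrassCurve ℚ} [W.IsElliptic] [W.IsGloballyMinimal]
  [W'.IsElliptic] [W'.IsGloballyMinimal] {p : ℕ} [Fact p.Prime]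

/-- **Route G on the leaf: Mazur's main conjecture at `E₀`** from `μ_an(E₀) = 0`, `λ_an(E₀) = n`, a
CLOSED congruent partner `E₀'` (good ordinary Eisenstein at `p`, `μ_an = 0`, `λ_an = n'`, Mazur's MC),
`E₀[p] ≅ E₀'[p]`, the transfer `λ(E₀) = λ(E₀') + e`, and `n ≤ n' + e + 1` — parity is automatic on the
leaf (`λ_an` even: `ParitySqueeze.Leaf.even_of_analyticLambdaEq`; `λ(f_E)` even: Prop. 3.10 at corank
`0`, Kato finiteness via Gross–Zagier–Kolyvagin). Facts `hW16`, `h310`, `hmod`, `hGZK` all PUBLISHED.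
[cite: GreenbergLNM1716, Prop. 3.10] [cite: GreenbergVatsal2000, §2 p. 27]
[cite: Wuthrich2014, Thm. 16 (p. 397)] -/
theorem Leaf.mazurMainConjecture_of_congruent
    (hW16 : Wuthrich2014.charIdeal_dvd_padicLFunction)
    (h310 : prop310_selmerCorank_mod_two_eq_lambdaInvariant)
    (hmod : nonempty_modularParametrizationData)
    (hGZK : rank_eq_analyticRank_of_analyticRank_le_one) (hL : RankZero.Leaf W p)
    (hgood' : W'.HasGoodReductionAtPrime p) (hord' : ¬ (p : ℤ) ∣ W'.frobeniusTrace p)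
    (hred' : ¬ W'.HasIrreducibleModPGaloisRep p)
    (hμ : AnalyticMuLE W p 0) (hμ' : AnalyticMuLE W' p 0)
    (hMC' : MazurMainConjecture W' p) {n' : ℕ} (hlam' : AnalyticLambdaEq W' p n')
    (hiso : TorsionIso W W' p) {e : ℤ} (hG : CongruentLambdaShift W W' p e)
    {n : ℕ} (hlam : AnalyticLambdaEq W p n) (hne : (n : ℤ) ≤ n' + e + 1) :
    MazurMainConjecture W p :=
  have hX := isClassX1_of_classX1 hL.classX1
  mazurMainConjecture_of_congruentLambdaShift_of_even hW16 h310 hmod hX.two_ne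
    hX.hasGoodReductionAtPrime hX.not_dvd_frobeniusTrace hX.not_hasIrreducibleModPGaloisRep
    (TamagawaSqueeze.Leaf.finite_selmerGroupPInfty hmod hGZK hL) hgood' hord' hred' hμ hμ' hMC' hlam'
    hiso hG (ParitySqueeze.Leaf.even_of_analyticLambdaEq hW16 hmod hL hlam) hlam hne

/-- **Route G on the leaf, headline: `BSD(E₀, p)`** from `μ_an(E₀) = 0 ∧ λ_an(E₀) = n`, a closed
congruent partner (`μ_an = 0`, `λ_an = n'`, Mazur's MC — per pair by routes S/P/T/C or x1b's P1/P3),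
`E₀[p] ≅ E₀'[p]`, `λ(E₀) = λ(E₀') + e` (Greenberg–Vatsal §2) and `n ≤ n' + e + 1`; through
`RankZero.Leaf.mazurMainConjecture_iff_bsdp` (Greenberg 4.1, modularity, Gross–Zagier–Kolyvagin; all
PUBLISHED). On the census (`N < 2·10⁴`, `p = 3`) this closes 14 classes unreachable by S/P/T/C, e.g.
`5150t1@3` from `7210g1@3` (`n = n' = 4`, `e = 0`) and `10370b1@3` from `1708a1@3` (`n = 6`, `n' = 4`,
`e = 2`). [cite: GreenbergVatsal2000, §2 p. 27] [cite: GreenbergLNM1716, Prop. 3.10 and Thm. 4.1]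
[cite: Wuthrich2014, Thm. 16 (p. 397)] -/
theorem Leaf.bsdp_of_muZero_of_congruent
    (hW16 : Wuthrich2014.charIdeal_dvd_padicLFunction) (hGr : greenberg_charValue_rankZero)
    (h310 : prop310_selmerCorank_mod_two_eq_lambdaInvariant)
    (hmod : nonempty_modularParametrizationData)
    (hGZK : rank_eq_analyticRank_of_analyticRank_le_one) (hL : RankZero.Leaf W p)
    (hgood' : W'.HasGoodReductionAtPrime p) (hord' : ¬ (p : ℤ) ∣ W'.frobeniusTrace p)
    (hred' : ¬ W'.HasIrreducibleModPGaloisRep p)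
    (hμ : AnalyticMuLE W p 0) (hμ' : AnalyticMuLE W' p 0)
    (hMC' : MazurMainConjecture W' p) {n' : ℕ} (hlam' : AnalyticLambdaEq W' p n')
    (hiso : TorsionIso W W' p) {e : ℤ} (hG : CongruentLambdaShift W W' p e)
    {n : ℕ} (hlam : AnalyticLambdaEq W p n) (hne : (n : ℤ) ≤ n' + e + 1) : BSDp W p :=
  (RankZero.Leaf.mazurMainConjecture_iff_bsdp hW16 hGr hmod hGZK hL).mp
    (Leaf.mazurMainConjecture_of_congruent hW16 h310 hmod hGZK hL hgood' hord' hred' hμ hμ' hMC'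
      hlam' hiso hG hlam hne)

/-- **Route G between two LEAF classes** (the common case on the census: the partner `W'` is itself a
leaf pair, closed by S/P/T/C): the reduction hypotheses on `W'` are read off `RankZero.Leaf W' p`.
[cite: GreenbergVatsal2000, §2 p. 27] [cite: Wuthrich2014, Thm. 16 (p. 397)] -/
theorem Leaf.bsdp_of_muZero_of_congruent_leaf
    (hW16 : Wuthrich2014.charIdeal_dvd_padicLFunction) (hGr : greenberg_charValue_rankZero)
    (h310 : prop310_selmerCorank_mod_two_eq_lambdaInvariant)
    (hmod : nonempty_modularParametrizationData)
    (hGZK : rank_eq_analyticRank_of_analyticRank_le_one) (hL : RankZero.Leaf W p)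
    (hL' : RankZero.Leaf W' p) (hμ : AnalyticMuLE W p 0) (hμ' : AnalyticMuLE W' p 0)
    (hMC' : MazurMainConjecture W' p) {n' : ℕ} (hlam' : AnalyticLambdaEq W' p n')
    (hiso : TorsionIso W W' p) {e : ℤ} (hG : CongruentLambdaShift W W' p e)
    {n : ℕ} (hlam : AnalyticLambdaEq W p n) (hne : (n : ℤ) ≤ n' + e + 1) : BSDp W p :=
  have hX' := isClassX1_of_classX1 hL'.classX1
  Leaf.bsdp_of_muZero_of_congruent hW16 hGr h310 hmod hGZK hL hX'.hasGoodReductionAtPrime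
    hX'.not_dvd_frobeniusTrace hX'.not_hasIrreducibleModPGaloisRep hμ hμ' hMC' hlam' hiso hG hlam hne

/-- **Consistency (Kato–Wuthrich direction): the transferred value never exceeds `λ_an(E₀)`.** On the
leaf, with a closed congruent partner as above and `λ_an(E₀) = n`: `n' + e ≤ n` (the data exist:
modularity, the cyclotomic `κ, γ`, a dual datum; `ϖ·L_p = ι(f_E·h)` gives
`n = λ(f_E) + λ(h) ≥ λ(f_E) = λ(X) = n' + e`). With Mazur's main conjecture at `E₀` this is an
equality; the census checks it on 794 closed–closed pairs (X1R0-GAPMAP §16.2: 0 violations).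
[cite: GreenbergVatsal2000, §2 p. 27] [cite: Wuthrich2014, Thm. 16 (p. 397)] -/
theorem Leaf.le_of_congruentLambdaShift
    (hW16 : Wuthrich2014.charIdeal_dvd_padicLFunction) (hmod : nonempty_modularParametrizationData)
    (hL : RankZero.Leaf W p)
    (hgood' : W'.HasGoodReductionAtPrime p) (hord' : ¬ (p : ℤ) ∣ W'.frobeniusTrace p)
    (hred' : ¬ W'.HasIrreducibleModPGaloisRep p)
    (hμ : AnalyticMuLE W p 0) (hμ' : AnalyticMuLE W' p 0)
    (hMC' : MazurMainConjecture W' p) {n' : ℕ} (hlam' : AnalyticLambdaEq W' p n')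
    (hiso : TorsionIso W W' p) {e : ℤ} (hG : CongruentLambdaShift W W' p e)
    {n : ℕ} (hlam : AnalyticLambdaEq W p n) : (n' : ℤ) + e ≤ n := by
  have hX := isClassX1_of_classX1 hL.classX1
  haveI : NeZero (W.conductorNorm ℤ) := ⟨(W.conductorNorm_pos_holds).ne'⟩
  obtain ⟨κ, hκ, γ, hγ, hγ'⟩ := exists_isCyclotomic_isTopGenerator_isCyclotomicVariable_holds p
  obtain ⟨D⟩ := W.nonempty_selmerDualData_holds κ γ hγ
  haveI : Module.Finite (IwasawaAlgebra p) D.X := D.module_finite_holds hγ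
  obtain ⟨hXt, f, ϖ, g, h, hf, hϖ, hchar, hι⟩ := isTorsion_and_exists_factorisation hW16 hmod
    hX.two_ne hX.hasGoodReductionAtPrime hX.not_dvd_frobeniusTrace hX.not_hasIrreducibleModPGaloisRep
    hκ hγ hγ' D
  have hgh : g * h ≠ 0 :=
    mul_ne_zero_of_iota_eq hX.hasGoodReductionAtPrime hX.not_dvd_frobeniusTrace hf hϖ D hι
  have hg0 : g ≠ 0 := fun h0 ↦ hgh (by rw [h0, zero_mul])
  have hh0 : h ≠ 0 := fun h0 ↦ hgh (by rw [h0, mul_zero])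
  have h1 : lam (g * h) = n := hlam f hf ϖ hϖ (g * h) hι
  have h2 : lam g = lambdaInvariant p D.X := lam_generator_eq_lambdaInvariant D.X hXt hg0 hchar
  obtain ⟨-, h3⟩ := lambdaInvariant_eq_of_congruentLambdaShift hW16 hmod hX.two_ne
    hX.hasGoodReductionAtPrime hX.not_dvd_frobeniusTrace hX.not_hasIrreducibleModPGaloisRep hgood'
    hord' hred' hμ hμ' hMC' hlam' hiso hG hκ hγ hγ' D
  have h4 : lam g ≤ lam (g * h) := lam_le_lam_mul hg0 hh0
  omega

end Leaf

end Summit.BirchSwinnertonDyer.Rank1Residual.X1.CongruenceTransfer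

end
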